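/-
Copyright (c) 2026 the pub-hodgecm-mathlib formalisation cell (harness21).  Prover seat hodgecm-mathlib-LH4-p07 (g9), req620 Track A «(D-RAM) FOUR-FRAME» squad
(STAGE-1b, row-(2) lineage; dealer LH4-plan (g13) WORD #58 RULING A ∕ #59 ∕ #64 ∕ #65: owner of the two-literal census law of `lev_{a,m}`, RamK lane), 2026-09-04.
-/
import Summits.HodgeConjecture.HodgeConjecture.Theorems.F0P3cDyRamToricLevelCensusRamKTopValue   -- ★ (F0P3-p01 (g33)): (D3) row in `hvTop` value form, `μ = λ − u`; brings part 1, ★ g32 index form, the z-letter lemmas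
import HarnessLib

/-!
# Crux `H413`, line LH4 «(D-RAM) FOUR-FRAME» — STAGE-1b, row (2): (D3♯)-RamK «THE TOP ROW OF THE SCALED MULTIPLIER `μ₁ = t⁻¹(λ − u)` IN `hvTop` VALUE FORM — ALIVE UP TO THE UNSCALED CONDUCTOR»
# `#levelSetDep_h(j,a;t⁻¹(λ−u)) = [2j + d ≤ 2jl₁ + 1 + e ∧ (j + a + 2 ≤ m₁ + 2d ∨ S)]·(1∣2)·q^{j − (j+a−m₁+1)∕2}`,  `|t| = exp(−e)`, `ρt = t`, `(m₁, jl₁) = (m − e, jλ − e)`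

Cell `hodgecm-mathlib` (D-0151), FLOOR 0, crux item H413 = `stmt-HodgeConjecture-24833`, route of record `HCCMUnconditional`; squad F0∕P3c∕LH4; lane
`--supports stmt-HodgeConjecture-24833 --as helper` (count-neutral; pays NO tier-0 row).  THEOREMS ONLY (no `def`, no instance, no notation, no `sorry`, default heartbeats).
OWNER'S ORGAN №5 for the END `levels_typeTwo_censusLaw` (scope `F0/P3c/LH4/LH4-p07/g9/SCOPE-T5P-cone.v1.LH4p07g9.md`, twin `LAW-FIT-RamK.v*`).

THE OBJECT.  The cone cells of a template piece `lev_{a′,b′}` are the depth cells of the SCALED multiplier `μ₁ = (jE c)⁻¹(λ − jE u₀₀)`, `|jE c| = |jE ϖ|^{a′}`, `ρ (jE c) = jE c`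
(★ p859713).  The (D0)–(D2) tables (★ `ncard_levelSetDep_zero ∕ _offDiag ∕ _diag_low`, type-free) and the (D3) INDEX form (★ g32 `ncard_levelSetDep_top_mul_eq_of_ramK`) hold for ANY
multiplier at its own tokens; the (D3) VALUE form (★ F0P3-p01 (g33) `ncard_levelSetDep_top_ramK_eq`, the `hvTop` sentence of ★ T5s) is stated for `μ = λ − u`.  THIS FILE is its
twin for `μ₁ = t⁻¹(λ − u)` with `t` `ρ`-fixed, `|t| = exp(−e)`: the hyperbolic bit `BIT(h, μ₁, c′)` has `ρμ₁∕μ₁ = ρμ∕μ` (the element's twist `κ`), so ★ g33's law «ALIVE(z, c′) ⟺ c′ + d ≤ jλ + 1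
∧ (c′ + 2 ≤ 2d ∨ S)» (a law of `κ` and of the unit `z` of the two line models, UNSCALED conductor `jλ`) evaluates it; on the top diagonal of `μ₁` (`j + m₁ = jl₁ + a`, `c′ = j + a − m₁`)
this reads `2j + d ≤ 2jl₁ + 1 + e` — the ALIVE OFFSET `e` of ★ (this seat) `…RamKCutOffset.toricCensusSum_ramK_cut_offset`.  Everything else (index → value ★ `eq_value_of_mul_idx_eq`, the
side suppliers discharged from the frame, the exclusivity of the far cells) is ★ g33's proof VERBATIM at the tokens `(m₁, jl₁)`.
* `ncard_levelSetDep_top_ramK_eq_inv_mul` — ★ g33's binders + `(t) (hρt) (e) (hte) (m₁ jl₁) (hme : m₁ + e = m) (hjle : jl₁ + e = jλ)`, top cell `(j, a)` of `μ₁`; BOTH line models.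
READING.  With (D0)–(D2) at `(m₁, jl₁)` and this row, the census of `lev_{a′,b′}` on type RamK satisfies ★ T5s's table hypotheses with `hvTopE` (offset `e = a′`) — the input of
★ `toricCensusSum_ramK_cut_offset`; the cut then erases the offset (`D ≥ d − 1`).  (adapted from ★ `F0P3cDyRamToricLevelCensusRamKTopValue` §3, F0P3-p01 (g33).)
HONEST LABEL.  Count-neutral local algebra over ★ organs; nothing printed is asserted; no census law is stated; `HC_CM` is proved only modulo the 7 printed citations (2 remaining named inputs:
hLiu418 = `stmt-HodgeConjecture-24832`, h413 = `stmt-HodgeConjecture-24833`) until rung 0 closes.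

## References
* [Flicker1998UnitaryFL] Y. Z. Flicker, *Elementary proof of the fundamental lemma for a unitary group*, Canad. J. Math. 50 (1998): Prop. 7 p. 84.
* [Kottwitz1986BaseChangeUnits] R. E. Kottwitz, *Base change for unit elements of Hecke algebras*, Compositio Math. 60 (1986): §1 pp. 240–241.
* [Serre1979] J.-P. Serre, *Local Fields*, GTM 67 (1979): Ch. V §2 Prop. 3, §3 Prop. 5 and Cor. 3; Ch. III §6 Prop. 12.
* [Jacobowitz1962] R. Jacobowitz, *Hermitian forms over local fields*, Amer. J. Math. 84 (1962): §4.
-/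

set_option autoImplicit false

namespace Summit.HodgeConjecture.HodgeConjecture.Cruxes.H413.F0P3cDyRamToricLevelCensusRamKTopValueScaled

open WithZero IsLocalRing
open scoped Valued
open Literature.NumberTheory.Automorphic.UnitaryThreeFourFrame (IsRamifiedQuadraticDatum)
open Literature.NumberTheory.LocalFields.WildQuadraticDatum
open Summit.HodgeConjecture.HodgeConjecture.Cruxes.H413.F0P3cDyRamToricCensusDefs
open Summit.HodgeConjecture.HodgeConjecture.Cruxes.H413.F0P3cDyRamToricLevelCensusUnr (token_kappa)
open Summit.HodgeConjecture.HodgeConjecture.Cruxes.H413.F0P3cDyRamTopDepthRamK (v_eq_one_of_v_sub_one_le)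
open Summit.HodgeConjecture.HodgeConjecture.Cruxes.H413.F0P3cDyRamTopSideRamK
open Summit.HodgeConjecture.HodgeConjecture.Cruxes.H413.F0P3cDyRamToricLevelCensusRamK

variable {K : Type} [Field K] [Valued K ℤᵐ⁰] {ρ Θ : K →+* K} {α ϖE : K}
variable {K' : Type} [Field K'] [Valued K' ℤᵐ⁰] {σ' : K' →+* K'} {α' π' : K'}   -- the third field `K' ≅ K♮ = Fix Θ`

open scoped Classical in
/-- **(D3♯) THE TOP ROW OF THE SCALED MULTIPLIER `μ₁ = t⁻¹(λ − u)`, `hvTop` VALUE FORM, TYPE RamK, BOTH SIDES.**  ★ g33 `ncard_levelSetDep_top_ramK_eq`'s frame and letters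
VERBATIM (two-field RamK frame; `h` hyperbolic, `h′` anisotropic; `λΘλ = 1`, `ρu = u`, `uΘu = 1`; UNSCALED tokens `|λ − u| = exp(−m)`, `|(λ−u) − ρ(λ−u)| = exp(−jλ)`, `m ≡ jλ (2)`, `2 ≤ d`;
the side proposition `S` agreeing with the hyperbolic bit at one far depth), plus a `ρ`-fixed scaling element `t` with `|t| = exp(−e)` and the scaled tokens `m₁ + e = m`, `jl₁ + e = jλ`.
On every top cell of `μ₁` (`j ≤ jl₁`, `1 ≤ a`, `j + m₁ = jl₁ + a`, `m₁ + 1 ≤ 2a`):  `#levelSetDep_h(j, a; t⁻¹(λ − u)) = if 2j + d ≤ 2jl₁ + 1 + e ∧ (j + a + 2 ≤ m₁ + 2d ∨ S) then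
(if j + a + 2 ≤ m₁ + 2d then 1 else 2)·q^(j − (j+a−m₁+1)∕2) else 0`, and the same for `h′` with `¬S` — the cells stay ALIVE up to the UNSCALED conductor (offset `e`).
[cite: Flicker1998UnitaryFL, Prop. 7 p. 84] [cite: Kottwitz1986BaseChangeUnits, §1 pp. 240–241] [cite: Serre1979, Ch. V §3 Prop. 5, Cor. 3] [cite: Jacobowitz1962, §4] -/
theorem ncard_levelSetDep_top_ramK_eq_inv_mul [CompleteSpace K] [IsDiscreteValuationRing 𝒪[K]] [Finite 𝓀[K]]
    [CompleteSpace K'] [IsDiscreteValuationRing 𝒪[K']] [Finite 𝓀[K']]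
    (hρρ : ∀ x, ρ (ρ x) = x) (hvρ : ∀ x, Valued.v (ρ x) = Valued.v x) (hΘρ : ∀ x, Θ (ρ x) = ρ (Θ x))
    (hα1 : Valued.v α ≤ 1) (hα : Valued.v (α - ρ α) = 1) {d t : ℕ} (hD : IsRamifiedQuadraticDatum Θ ϖE d t) (hρϖ : ρ ϖE = ϖE)
    {q : ℕ} (hq : Nat.card 𝓀[K] = q ^ 2)
    (hσ' : ∀ x, σ' (σ' x) = x) (hvσ' : ∀ x, Valued.v (σ' x) = Valued.v x) (hα'1 : Valued.v α' ≤ 1) (hα' : Valued.v (α' - σ' α') = 1)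
    (hπ' : Valued.v π' = exp (-1 : ℤ)) (hq' : Nat.card 𝓀[K'] = q ^ 2)
    (jK : K' →+* K) (hjv : ∀ x, Valued.v (jK x) = Valued.v x ^ 2) (hjΘ : ∀ x, Θ (jK x) = jK x) (hjfix : ∀ z : K, Θ z = z → ∃ x, jK x = z)
    (hjσ : ∀ x, jK (σ' x) = ρ (jK x))
    {h h' : K} (hΘh : Θ h = h) (hh : h ≠ 0) (hhyper : ∃ x : K, x ≠ 0 ∧ h * Θ x * x + ρ (h * Θ x * x) = 0)
    (hΘh' : Θ h' = h') (hh' : h' ≠ 0) (haniso : ¬ ∃ x : K, x ≠ 0 ∧ h' * Θ x * x + ρ (h' * Θ x * x) = 0)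
    {lam u : K} (hlam : lam * Θ lam = 1) (hu : ρ u = u) (hu1 : u * Θ u = 1)
    {m jl : ℕ} (hm : Valued.v (lam - u) = exp (-(m : ℤ))) (hjl : Valued.v ((lam - u) - ρ (lam - u)) = exp (-(jl : ℤ)))
    (hmjl : m % 2 = jl % 2) (hd2 : 2 ≤ d)
    {tc : K} (hρt : ρ tc = tc) {e : ℕ} (hte : Valued.v tc = exp (-(e : ℤ))) {m₁ jl₁ : ℕ} (hme : m₁ + e = m) (hjle : jl₁ + e = jl)
    {S : Prop} (hS : 3 * d ≤ jl + 2 → ∃ c₀ : ℕ, 2 * d ≤ c₀ + 1 ∧ c₀ + d ≤ jl + 1 ∧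
      (S ↔ ∃ ω₁ : Kˣ, Valued.v (ω₁ : K) = 1 ∧
        Valued.v (1 + ρ h / h / (ρ (lam - u) / (lam - u)) * (ρ ((ω₁ : K) * Θ ω₁) / ((ω₁ : K) * Θ ω₁))) ≤ exp (-(c₀ : ℤ))))
    {j a : ℕ} (hj : j ≤ jl₁) (ha : 1 ≤ a) (hdiag : j + m₁ = jl₁ + a) (htop : m₁ + 1 ≤ 2 * a) :
    ((levelSetDep ρ Θ α ϖE h j a (tc⁻¹ * (lam - u))).ncard =
      if 2 * j + d ≤ 2 * jl₁ + 1 + e ∧ (j + a + 2 ≤ m₁ + 2 * d ∨ S) then (if j + a + 2 ≤ m₁ + 2 * d then 1 else 2) * q ^ (j - (j + a - m₁ + 1) / 2) else 0) ∧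
    ((levelSetDep ρ Θ α ϖE h' j a (tc⁻¹ * (lam - u))).ncard =
      if 2 * j + d ≤ 2 * jl₁ + 1 + e ∧ (j + a + 2 ≤ m₁ + 2 * d ∨ ¬ S) then (if j + a + 2 ≤ m₁ + 2 * d then 1 else 2) * q ^ (j - (j + a - m₁ + 1) / 2) else 0) := by
  classical
  -- ## the datum's clauses
  have hΘΘ : ∀ x, Θ (Θ x) = x := hD.1
  have hvΘ : ∀ x, Valued.v (Θ x) = Valued.v x := hD.2.1
  have hϖE : Valued.v ϖE = exp (-1 : ℤ) := hD.2.2.1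
  have hΘev : ∀ x : K, Θ x = x → x ≠ 0 → ∃ n : ℤ, Valued.v x = exp (2 * n) := hD.2.2.2.1
  have hdatum : Valued.v (ϖE - Θ ϖE) = Valued.v ϖE ^ d := hD.2.2.2.2.1
  have hd1 : 1 ≤ d := hD.2.2.2.2.2.1
  have hρΘ : ∀ x, ρ (Θ x) = Θ (ρ x) := fun x => (hΘρ x).symm
  have hΘϖ : Θ ϖE ≠ ϖE := fun h0 => by
    rw [h0, sub_self, map_zero, v_varpi_pow hϖE] at hdatum
    exact exp_ne_zero hdatum.symm
  haveI : IsAdicComplete 𝓂[K] 𝒪[K] := Literature.NumberTheory.LocalFields.isAdicComplete_valuedInteger_of_completeSpace hϖE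
  have hq1 : 1 ≤ q := by
    by_contra h0
    have h1 : Nat.card 𝓀[K] = 0 := by rw [hq]; simp [show q = 0 by omega]
    exact (Nat.card_pos (α := 𝓀[K])).ne' h1
  -- ## the Θ-fixed unramified generator `αK := jK α′`
  have hΘαK : Θ (jK α') = jK α' := hjΘ α'
  have hαK1 : Valued.v (jK α') ≤ 1 := by rw [hjv]; exact pow_le_one' hα'1 _
  have hαKρ : Valued.v (jK α' - ρ (jK α')) = 1 := by rw [← hjσ, ← map_sub, hjv, hα', one_pow]
  -- ## the token
  obtain ⟨hκ1, hκ, -, hκΘ, hmjl'⟩ := token_kappa hρρ hvρ hΘρ hvΘ hlam hu hu1 hm hjl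
  have hμ0 : lam - u ≠ 0 := fun h0 => by rw [h0, map_zero] at hm; exact (exp_ne_zero hm.symm).elim
  -- ## the scaled multiplier `μ₁ = t⁻¹(λ − u)`: tokens and twist
  have ht0 : tc ≠ 0 := fun h0 => by rw [h0, map_zero] at hte; exact (exp_ne_zero hte.symm).elim
  have hm1 : Valued.v (tc⁻¹ * (lam - u)) = exp (-(m₁ : ℤ)) := by
    rw [map_mul, map_inv₀, hte, hm, ← exp_neg, ← exp_add]; congr 1; omega
  have hjl1 : Valued.v (tc⁻¹ * (lam - u) - ρ (tc⁻¹ * (lam - u))) = exp (-(jl₁ : ℤ)) := by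
    rw [show tc⁻¹ * (lam - u) - ρ (tc⁻¹ * (lam - u)) = tc⁻¹ * ((lam - u) - ρ (lam - u)) by rw [map_mul, map_inv₀, hρt]; ring,
      map_mul, map_inv₀, hte, hjl, ← exp_neg, ← exp_add]; congr 1; omega
  have hκeq : ρ (tc⁻¹ * (lam - u)) / (tc⁻¹ * (lam - u)) = ρ (lam - u) / (lam - u) := by
    rw [map_mul, map_inv₀, hρt]; field_simp
  -- ## one unit for both line models
  obtain ⟨z, n₀, hz1, hκz, hΘn, hn1, hnn, hBz, hBz'⟩ :=
    exists_unit_of_lineModels hρρ hΘΘ hΘρ hvρ hvΘ hϖE hρϖ hΘev hαK1 hαKρ hΘh hh hhyper hΘh' hh' haniso hμ0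
  -- ## the side suppliers, discharged from the frame
  have hNF : ∀ f : K, ρ f = f → Θ f = f → Valued.v f = 1 → ∃ x : K, x * Θ x = f := fun f hρf hΘf hf =>
    exists_mul_map_eq_of_fixed_fixed_of_thirdField hρρ hvρ hΘρ hD hσ' hvσ' hα'1 hα' hπ' jK hjv hjΘ hjfix hjσ hρf hΘf hf
  have hNd : ∀ u : K, Θ u = u → Valued.v (u - 1) ≤ Valued.v ϖE ^ (2 * d) → ∃ x : K, x * Θ x = u := fun u hΘu hu =>
    let ⟨x, hx, _⟩ := exists_mul_map_eq_of_isRamifiedQuadraticDatum Θ ϖE d t hD u hΘu hu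
    ⟨x, hx⟩
  have hdich : ∃ c₀ : K, Θ c₀ = c₀ ∧ Valued.v c₀ = 1 ∧ ∀ u : K, Θ u = u → Valued.v u = 1 → (∃ x : K, x * Θ x = u) ∨ ∃ x : K, x * Θ x = c₀ * u :=
    exists_unit_norm_dichotomy_of_isRamifiedQuadraticDatum Θ ϖE d t hD
  obtain ⟨n₁, hΘn₁, hn₁1, hn₁le, hn₁n⟩ := exists_fixed_unit_not_norm_of_level_pow Θ ϖE d t hD (n := d - 1) (by omega)
  have hn₁c : ∀ c : ℕ, c + 2 ≤ 2 * d → Valued.v (n₁ - 1) ≤ exp (-(c : ℤ)) := fun c hc => by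
    refine hn₁le.trans ?_
    rw [Valuation.map_pow, v_varpi_pow hϖE, exp_le_exp]; omega
  -- ## the cell's depth `c′ = j + a − m₁`
  have haj : a ≤ j := by omega
  have ham : a ≤ m₁ := by omega
  have hpar : (j + a) % 2 = 0 := by omega
  obtain ⟨c', hc'⟩ : ∃ c' : ℕ, c' = j + a - m₁ := ⟨_, rfl⟩
  have hc'1 : 1 ≤ c' := by omega
  have hc'j : c' ≤ j := by omega
  have hrad : (-((j + a : ℕ) - (m₁ : ℤ))) = -((c' : ℕ) : ℤ) := by rw [hc']; push_cast; omega
  have htopIff : ∀ c : ℕ, 1 ≤ c →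
      ((∃ k e w : K, Θ k = k ∧ Valued.v k = 1 ∧ ρ e = e ∧ Valued.v e = 1 ∧ Valued.v (w - 1) ≤ exp (-(c : ℤ)) ∧ z = k * e * w) ↔ c + d ≤ jl + 1) :=
    fun c hc => exists_topDecomp_iff_le hρρ hΘΘ hΘρ hvρ hvΘ hϖE hρϖ hdatum hΘev hΘαK hαK1 hαKρ hz1 hκz hκΘ hc
  -- ## THE LAW at depth `c′`, hyperbolic side: ALIVE(z,c′) ⟺ c′ + d ≤ jl + 1 ∧ (c′ + 2 ≤ 2d ∨ S)
  have hLawP : (∃ x e w : K, Valued.v x = 1 ∧ ρ e = e ∧ Valued.v e = 1 ∧ Valued.v (w - 1) ≤ exp (-(c' : ℤ)) ∧ z = x * Θ x * e * w) ↔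
      (c' + d ≤ jl + 1 ∧ (c' + 2 ≤ 2 * d ∨ S)) := by
    constructor
    · intro hal
      have hcd : c' + d ≤ jl + 1 := (htopIff c' hc'1).1 (topDecomp_of_alive hΘΘ hvΘ hal)
      refine ⟨hcd, ?_⟩
      by_cases hnear : c' + 2 ≤ 2 * d
      · exact Or.inl hnear
      · right
        obtain ⟨c₀, hc₀far, hc₀D, hSc₀⟩ := hS (by omega)
        have hal₀ : ∃ x e w : K, Valued.v x = 1 ∧ ρ e = e ∧ Valued.v e = 1 ∧ Valued.v (w - 1) ≤ exp (-(c₀ : ℤ)) ∧ z = x * Θ x * e * w := by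
          rcases le_total c₀ c' with h01 | h10
          · exact alive_mono h01 hal
          · exact alive_of_alive_of_topDecomp hΘΘ hρΘ hvΘ hϖE hρϖ hΘϖ hΘev hd1 hNF hNd (by omega) h10 hal ((htopIff c₀ (by omega)).2 hc₀D)
        exact hSc₀.2 ((hBz c₀ (by omega)).2 hal₀)
    · rintro ⟨hcd, hside⟩
      have htop' := (htopIff c' hc'1).2 hcd
      by_cases hnear : c' + 2 ≤ 2 * d
      · exact alive_of_topDecomp_of_nonNorm_near hvΘ hdich hΘn₁ hn₁1 hn₁n (hn₁c c' hnear) htop'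
      · have hSv : S := hside.resolve_left hnear
        obtain ⟨c₀, hc₀far, hc₀D, hSc₀⟩ := hS (by omega)
        have hal₀ := (hBz c₀ (by omega)).1 (hSc₀.1 hSv)
        rcases le_total c' c₀ with h01 | h10
        · exact alive_mono h01 hal₀
        · exact alive_of_alive_of_topDecomp hΘΘ hρΘ hvΘ hϖE hρϖ hΘϖ hΘev hd1 hNF hNd hc₀far h10 hal₀ htop'
  -- ## THE LAW at depth `c′`, anisotropic side: ALIVE(z·n₀,c′) ⟺ c′ + d ≤ jl + 1 ∧ (c′ + 2 ≤ 2d ∨ ¬S)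
  have hLawM : (∃ x e w : K, Valued.v x = 1 ∧ ρ e = e ∧ Valued.v e = 1 ∧ Valued.v (w - 1) ≤ exp (-(c' : ℤ)) ∧ z * n₀ = x * Θ x * e * w) ↔
      (c' + d ≤ jl + 1 ∧ (c' + 2 ≤ 2 * d ∨ ¬ S)) := by
    have hexcl : ∀ (h₁ : ∃ x e w : K, Valued.v x = 1 ∧ ρ e = e ∧ Valued.v e = 1 ∧ Valued.v (w - 1) ≤ exp (-(c' : ℤ)) ∧ z = x * Θ x * e * w)
        (h₂ : ∃ x e w : K, Valued.v x = 1 ∧ ρ e = e ∧ Valued.v e = 1 ∧ Valued.v (w - 1) ≤ exp (-(c' : ℤ)) ∧ z * n₀ = x * Θ x * e * w),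
        2 * d ≤ c' + 1 → False := fun h₁ h₂ hfar => by
      refine not_alive_and_alive_mul_nonNorm hΘΘ hρΘ hvΘ hϖE hρϖ hΘϖ hΘev hd1 hNF hNd hΘn hnn (map_one ρ) (Valuation.map_one _) hfar h₁ ?_
      obtain ⟨x, e, w, hx, hρe, hve, hw, hzz⟩ := h₂
      exact ⟨x, e, w, hx, hρe, hve, hw, by rw [mul_one, hzz]⟩
    constructor
    · intro hal
      have htop' := (topDecomp_mul_iff (ρ := ρ) hΘn hn1 c').1 (topDecomp_of_alive hΘΘ hvΘ hal)
      have hcd : c' + d ≤ jl + 1 := (htopIff c' hc'1).1 htop'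
      refine ⟨hcd, ?_⟩
      by_cases hnear : c' + 2 ≤ 2 * d
      · exact Or.inl hnear
      · right
        intro hSv
        exact hexcl (hLawP.2 ⟨hcd, Or.inr hSv⟩) hal (by omega)
    · rintro ⟨hcd, hside⟩
      have htop' := (htopIff c' hc'1).2 hcd
      by_cases hnear : c' + 2 ≤ 2 * d
      · exact alive_of_topDecomp_of_nonNorm_near hvΘ hdich hΘn₁ hn₁1 hn₁n (hn₁c c' hnear) ((topDecomp_mul_iff (ρ := ρ) hΘn hn1 c').2 htop')
      · have hnS : ¬ S := hside.resolve_left hnear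
        rcases alive_or_alive_mul_of_topDecomp (ρ := ρ) hvΘ hdich hΘn hn1 hnn htop' with hP | hM
        · exact absurd ((hLawP.1 hP).2.resolve_left hnear) hnS
        · exact hM
  -- ## ★ g32's index form for both scalars, the bit closed, the arithmetic
  have GP := ncard_levelSetDep_top_mul_eq_of_ramK hρρ hvρ hΘρ hα1 hα hD hρϖ hΘh hh hq hσ' hvσ' hα'1 hα' hπ' hq' jK hjv hjΘ hjfix hjσ
    hm1 hjl1 ha haj ham hdiag htop hpar
  have GM := ncard_levelSetDep_top_mul_eq_of_ramK hρρ hvρ hΘρ hα1 hα hD hρϖ hΘh' hh' hq hσ' hvσ' hα'1 hα' hπ' hq' jK hjv hjΘ hjfix hjσ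
    hm1 hjl1 ha haj ham hdiag htop hpar
  rw [hrad, hκeq] at GP GM
  rw [← hc'] at GP GM ⊢
  have hBP : (∃ ω₁ : Kˣ, Valued.v (ω₁ : K) = 1 ∧
      Valued.v (1 + ρ h / h / (ρ (lam - u) / (lam - u)) * (ρ ((ω₁ : K) * Θ ω₁) / ((ω₁ : K) * Θ ω₁))) ≤ exp (-(c' : ℤ))) ↔
      (2 * j + d ≤ 2 * jl₁ + 1 + e ∧ (j + a + 2 ≤ m₁ + 2 * d ∨ S)) := by
    rw [hBz c' hc'1, hLawP]; constructor <;> rintro ⟨h1, h2⟩ <;> refine ⟨by omega, h2.imp (by omega) id⟩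
  have hBM : (∃ ω₁ : Kˣ, Valued.v (ω₁ : K) = 1 ∧
      Valued.v (1 + ρ h' / h' / (ρ (lam - u) / (lam - u)) * (ρ ((ω₁ : K) * Θ ω₁) / ((ω₁ : K) * Θ ω₁))) ≤ exp (-(c' : ℤ))) ↔
      (2 * j + d ≤ 2 * jl₁ + 1 + e ∧ (j + a + 2 ≤ m₁ + 2 * d ∨ ¬ S)) := by
    rw [hBz' c' hc'1, hLawM]; constructor <;> rintro ⟨h1, h2⟩ <;> refine ⟨by omega, h2.imp (by omega) id⟩
  have hnearIff : c' + 2 ≤ 2 * d ↔ j + a + 2 ≤ m₁ + 2 * d := by omega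
  constructor
  · have H := eq_value_of_mul_idx_eq hq1 hd2 hc'1 hc'j _ (by rw [ite_congr (propext hBP) (fun _ => rfl) (fun _ => rfl)] at GP; exact GP)
    rw [H]; simp only [hnearIff]
  · have H := eq_value_of_mul_idx_eq hq1 hd2 hc'1 hc'j _ (by rw [ite_congr (propext hBM) (fun _ => rfl) (fun _ => rfl)] at GM; exact GM)
    rw [H]; simp only [hnearIff]

end Summit.HodgeConjecture.HodgeConjecture.Cruxes.H413.F0P3cDyRamToricLevelCensusRamKTopValueScaled
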